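import Literature.MathematicalPhysics.QuantumFieldTheory.ConformalBootstrap3D.MeanFieldCoefficients
import Mathlib.Tactic
import HarnessLib

/-!
# SL(2) block coefficients: `1/z` and `(1-z)∂_z` act tridiagonally on `k_{2h}(z) = z^h ₂F₁(h,h;2h;z)`

The one-dimensional (SL(2)) conformal block, or "`k`-function", is `k_{2h}(z) = z^h ₂F₁(h,h;2h;z)`
(Dolan–Osborn 2004 §2, Dolan–Osborn 2011 eq. (4.5); Hogervorst 2016 eq. (2.7) `k_{2β}`): as a generalised
power series `k_{2h}(z) = Σ_{i ≥ 0} κ_h(i) z^{h+i}` with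

  `κ_h(i) = (h)_i² / (i! (2h)_i)`   (`sl2Coeff h i`; `(x)_n = poch x n`).

This file records, at the level of the coefficient sequence `κ_h` (extended by zero to negative indices,
`sl2CoeffZ h : ℤ → ℝ`), three finite identities:

* `sl2CoeffZ_rec` — the hypergeometric ratio `(i+1)(2h+i) κ_h(i+1) = (h+i)² κ_h(i)`, i.e. the
  coefficient form of the eigen-equation `D_z k_{2h} = h(h-1) k_{2h}`, `D_z = z²(1-z)∂_z² - z²∂_z`
  (Dolan–Osborn 2011 eq. (2.11) at `a = b = 0`);
* `sl2CoeffZ_inv` (**T1**) — `κ_h(i) = κ_{h-1}(i) + ½ κ_h(i-1) + γ_h κ_{h+1}(i-2)`, the coefficient form of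
  `z⁻¹ k_{2h}(z) = k_{2h-2}(z) + ½ k_{2h}(z) + γ_h k_{2h+2}(z)`, `γ_h = h²/(4(2h-1)(2h+1))` (`sl2Gamma`);
* `sl2CoeffZ_deriv` (**T2**) — `(h+i) κ_h(i) - (h+i-1) κ_h(i-1) = h κ_{h-1}(i) - (h-1) γ_h κ_{h+1}(i-2)`, the
  coefficient form of `(1-z) k_{2h}'(z) = h k_{2h-2}(z) - (h-1) γ_h k_{2h+2}(z)`;

(both for `h > 1`, where `k_{2h-2}` is a genuine `k`-function), and the combination that does not involve
`k_{2h-2}` at all,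

* `sl2CoeffZ_comb` (**T0**) — `i κ_h(i) = (h/2 + i - 1) κ_h(i-1) - γ'_h κ_{h+1}(i-2)`, `γ'_h = h²/(4(2h+1))`
  (`sl2Gamma'`), i.e. `h z⁻¹ k_{2h} - (1-z) k_{2h}' = (h/2) k_{2h} + γ'_h k_{2h+2}`, valid for every `h > 0`.

T1/T2 are the three-term recurrences of the Legendre functions of the second kind in disguise
(`k_{2h}(z) ∝ Q_{h-1}(2/z - 1)`; `(ν+1) Q_{ν+1}(x) = (2ν+1) x Q_ν(x) - ν Q_{ν-1}(x)` and
`(x²-1) Q_ν'(x) = ν x Q_ν(x) - ν Q_{ν-1}(x)`, Whittaker–Watson §15.21, §15.3); here they are proved directly as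
polynomial identities in `(h, i)`. They are the input of `DimensionalReduction3D`: they say that the
difference of the three- and two-dimensional Casimir operators acts by NEAREST NEIGHBOURS on products
`k_{2h}(z) k_{2h'}(z̄)`, which turns Hogervorst's dimensional-reduction conjecture (JHEP 09 (2016) 017,
eq. (2.35)/"master") into a finite recurrence. Finite algebra only; nothing is summed.

[cite: DolanOsborn2011, §2 eq. (2.11), §4 eq. (4.5)] [cite: Hogervorst2016, §2 eq. (2.7)]
-/

namespace Literature.MathematicalPhysics.QuantumFieldTheory.ConformalBootstrap3D

open Finset

/-! ### The coefficients -/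

/-- `κ_h(i) = (h)_i² / (i! (2h)_i)`: the coefficient of `z^{h+i}` in `k_{2h}(z) = z^h ₂F₁(h,h;2h;z)`.
[cite: DolanOsborn2011, §4 eq. (4.5)] -/
noncomputable def sl2Coeff (h : ℝ) (i : ℕ) : ℝ :=
  poch h i ^ 2 / ((i.factorial : ℝ) * poch (2 * h) i)

/-- `κ_h(0) = 1`. [folklore] -/
@[simp] theorem sl2Coeff_zero (h : ℝ) : sl2Coeff h 0 = 1 := by
  simp [sl2Coeff]

/-- `κ_h(1) = h/2` for `h ≠ 0`. [folklore] -/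
theorem sl2Coeff_one {h : ℝ} (hh : h ≠ 0) : sl2Coeff h 1 = h / 2 := by
  unfold sl2Coeff
  rw [poch_one, poch_one, Nat.factorial_one, Nat.cast_one, one_mul, div_eq_div_iff (by positivity) two_ne_zero]
  ring

/-- `κ_h(i) ≥ 0` for `h > 0`. [folklore] -/
theorem sl2Coeff_nonneg {h : ℝ} (hh : 0 < h) (i : ℕ) : 0 ≤ sl2Coeff h i := by
  unfold sl2Coeff
  have := poch_pos (by linarith : 0 < 2 * h) i
  positivity

/-- `κ_h(i) > 0` for `h > 0`. [folklore] -/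
theorem sl2Coeff_pos {h : ℝ} (hh : 0 < h) (i : ℕ) : 0 < sl2Coeff h i := by
  unfold sl2Coeff
  have := poch_pos (by linarith : 0 < 2 * h) i
  have := poch_pos hh i
  positivity

/-- The hypergeometric ratio: `(i+1)(2h+i) κ_h(i+1) = (h+i)² κ_h(i)` (`h > 0`). Coefficientwise this is
`D_z k_{2h} = h(h-1) k_{2h}`. [cite: DolanOsborn2011, §2 eq. (2.11)] -/
theorem sl2Coeff_succ {h : ℝ} (hh : 0 < h) (i : ℕ) :
    ((i : ℝ) + 1) * (2 * h + i) * sl2Coeff h (i + 1) = (h + i) ^ 2 * sl2Coeff h i := by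
  unfold sl2Coeff
  rw [poch_succ, poch_succ, Nat.factorial_succ]
  have h1 : poch (2 * h) i ≠ 0 := poch_ne_zero (by linarith) i
  have h2 : (i.factorial : ℝ) ≠ 0 := by positivity
  have h3 : (2 * h + i) ≠ 0 := by positivity
  push_cast
  rw [mul_div_assoc', mul_div_assoc',
    div_eq_div_iff (mul_ne_zero (mul_ne_zero (by positivity) h2) (mul_ne_zero h1 h3)) (mul_ne_zero h2 h1)]
  ring

/-! ### Zero extension to integer indices -/

/-- `κ_h` extended by zero to `ℤ`: `sl2CoeffZ h i = κ_h(i)` for `i ≥ 0`, `0` for `i < 0`. [folklore] -/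
noncomputable def sl2CoeffZ (h : ℝ) (i : ℤ) : ℝ :=
  if 0 ≤ i then sl2Coeff h i.toNat else 0

/-- On natural indices the extension is `κ_h`. [folklore] -/
@[simp] theorem sl2CoeffZ_natCast (h : ℝ) (i : ℕ) : sl2CoeffZ h (i : ℤ) = sl2Coeff h i := by
  simp [sl2CoeffZ]

/-- Negative indices carry `0`. [folklore] -/
theorem sl2CoeffZ_of_neg (h : ℝ) {i : ℤ} (hi : i < 0) : sl2CoeffZ h i = 0 := by
  simp [sl2CoeffZ, not_le.mpr hi]

/-- `sl2CoeffZ h 0 = 1`. [folklore] -/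
@[simp] theorem sl2CoeffZ_zero (h : ℝ) : sl2CoeffZ h 0 = 1 := by
  simp [sl2CoeffZ]

/-- `sl2CoeffZ h 1 = κ_h(1)`. [folklore] -/
theorem sl2CoeffZ_one (h : ℝ) : sl2CoeffZ h 1 = sl2Coeff h 1 := by
  simpa using sl2CoeffZ_natCast h 1

/-- `sl2CoeffZ h (i+1)` at a natural `i`. [folklore] -/
theorem sl2CoeffZ_natCast_add_one (h : ℝ) (i : ℕ) : sl2CoeffZ h ((i : ℤ) + 1) = sl2Coeff h (i + 1) := by
  have : ((i : ℤ) + 1) = ((i + 1 : ℕ) : ℤ) := by push_cast; ring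
  rw [this, sl2CoeffZ_natCast]

/-- `sl2CoeffZ h (i+2)` at a natural `i`. [folklore] -/
theorem sl2CoeffZ_natCast_add_two (h : ℝ) (i : ℕ) : sl2CoeffZ h ((i : ℤ) + 2) = sl2Coeff h (i + 2) := by
  have : ((i : ℤ) + 2) = ((i + 2 : ℕ) : ℤ) := by push_cast; ring
  rw [this, sl2CoeffZ_natCast]

/-- Non-negativity of the extension (`h > 0`). [folklore] -/
theorem sl2CoeffZ_nonneg {h : ℝ} (hh : 0 < h) (i : ℤ) : 0 ≤ sl2CoeffZ h i := by
  unfold sl2CoeffZ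
  split_ifs
  · exact sl2Coeff_nonneg hh _
  · exact le_rfl

/-- **The ratio recursion on `ℤ`**: `(i+1)(2h+i) κ_h(i+1) = (h+i)² κ_h(i)` for every integer `i`
(both sides vanish for `i ≤ -1`). [cite: DolanOsborn2011, §2 eq. (2.11)] -/
theorem sl2CoeffZ_rec {h : ℝ} (hh : 0 < h) (i : ℤ) :
    ((i : ℝ) + 1) * (2 * h + i) * sl2CoeffZ h (i + 1) = (h + i) ^ 2 * sl2CoeffZ h i := by
  rcases lt_trichotomy i (-1) with hi | rfl | hi
  · rw [sl2CoeffZ_of_neg h (by omega), sl2CoeffZ_of_neg h (by omega)]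
    ring
  · simp [sl2CoeffZ_of_neg h (by norm_num : (-1 : ℤ) < 0)]
  · obtain ⟨n, rfl⟩ : ∃ n : ℕ, i = n := ⟨i.toNat, by omega⟩
    rw [sl2CoeffZ_natCast_add_one, sl2CoeffZ_natCast]
    exact_mod_cast sl2Coeff_succ hh n

/-! ### The tridiagonal identities -/

/-- `γ_h = h² / (4 (2h-1)(2h+1))`: the coefficient of `k_{2h+2}` in `z⁻¹ k_{2h}`. [folklore] -/
noncomputable def sl2Gamma (h : ℝ) : ℝ :=
  h ^ 2 / (4 * (2 * h - 1) * (2 * h + 1))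

/-- `γ'_h = (2h-1) γ_h = h² / (4 (2h+1))`, regular at `h = 1/2`. [folklore] -/
noncomputable def sl2Gamma' (h : ℝ) : ℝ :=
  h ^ 2 / (4 * (2 * h + 1))

/-- `(2h-1) γ_h = γ'_h` for `h ≠ 1/2`. [folklore] -/
theorem sl2Gamma'_eq {h : ℝ} (hh : 2 * h - 1 ≠ 0) : (2 * h - 1) * sl2Gamma h = sl2Gamma' h := by
  unfold sl2Gamma sl2Gamma'
  have h2 : (2 * h + 1) ≠ 0 ∨ (2 * h + 1) = 0 := by tauto
  rcases h2 with h2 | h2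
  · field_simp
  · simp [h2]

/-- `γ_h > 0` for `h > 1/2`. [folklore] -/
theorem sl2Gamma_pos {h : ℝ} (hh : 1 / 2 < h) : 0 < sl2Gamma h := by
  unfold sl2Gamma
  have : 0 < 2 * h - 1 := by linarith
  positivity

/-- `γ'_h > 0` for `h > 0`. [folklore] -/
theorem sl2Gamma'_pos {h : ℝ} (hh : 0 < h) : 0 < sl2Gamma' h := by
  unfold sl2Gamma'
  positivity

/-- `(h-1)_{i+1} = (h-1) (h)_i`. [folklore] -/
private theorem poch_pred_succ (h : ℝ) (i : ℕ) : poch (h - 1) (i + 1) = (h - 1) * poch h i := by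
  rw [poch_succ_left, sub_add_cancel]

/-- `(h+1)_i · h = (h)_i (h + i)`. [folklore] -/
private theorem poch_succ_param (h : ℝ) (i : ℕ) : h * poch (h + 1) i = poch h i * (h + i) := by
  rw [← poch_succ_left, poch_succ]

/-- Main case of **T1** and **T2** together, as the `μ`-linear family: for `h > 1` and `i : ℕ`,
`(μ - h - (i+2)) κ_h(i+2) + (h+i+1) κ_h(i+1) = (μ-h) κ_{h-1}(i+2) + (μ/2) κ_h(i+1) + (μ+h-1) γ_h κ_{h+1}(i)`.
[folklore] -/
private theorem sl2Coeff_T_main {h : ℝ} (hh : 1 < h) (μ : ℝ) (i : ℕ) :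
    (μ - h - ((i : ℝ) + 2)) * sl2Coeff h (i + 2) + (h + i + 1) * sl2Coeff h (i + 1) =
      (μ - h) * sl2Coeff (h - 1) (i + 2) + μ / 2 * sl2Coeff h (i + 1) +
        (μ + h - 1) * sl2Gamma h * sl2Coeff (h + 1) i := by
  unfold sl2Coeff sl2Gamma
  -- express everything through `P = (h)_i`, `Q = (2h)_i`
  have eP2 : poch h (i + 2) = poch h i * (h + i) * (h + i + 1) := by
    rw [poch_succ, poch_succ]; push_cast; ring
  have eP1 : poch h (i + 1) = poch h i * (h + i) := poch_succ h i
  have eQ2 : poch (2 * h) (i + 2) = poch (2 * h) i * (2 * h + i) * (2 * h + i + 1) := by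
    rw [poch_succ, poch_succ]; push_cast; ring
  have eQ1 : poch (2 * h) (i + 1) = poch (2 * h) i * (2 * h + i) := poch_succ (2 * h) i
  have eR2 : poch (h - 1) (i + 2) = (h - 1) * (poch h i * (h + i)) := by
    rw [poch_pred_succ, eP1]
  have eS2 : poch (2 * (h - 1)) (i + 2) = (2 * h - 2) * (2 * h - 1) * poch (2 * h) i := by
    have : 2 * (h - 1) = 2 * h - 2 := by ring
    rw [this, poch_succ_left, poch_succ_left]
    have e3 : 2 * h - 2 + 1 = 2 * h - 1 := by ring
    have e4 : 2 * h - 1 + 1 = 2 * h := by ring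
    rw [e3, e4]; ring
  have hP : poch h i ≠ 0 := poch_ne_zero (by linarith) i
  have hQ : poch (2 * h) i ≠ 0 := poch_ne_zero (by linarith) i
  have h0 : h ≠ 0 := by positivity
  have hU : poch (h + 1) i = poch h i * (h + i) / h := by
    rw [eq_div_iff h0, mul_comm, poch_succ_param]
  have hV : poch (2 * (h + 1)) i = poch (2 * h) i * (2 * h + i) * (2 * h + i + 1) / ((2 * h) * (2 * h + 1)) := by
    have hne : (2 * h) * (2 * h + 1) ≠ 0 := by positivity
    rw [eq_div_iff hne]
    have e5 : 2 * (h + 1) = (2 * h + 1) + 1 := by ring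
    rw [e5]
    have a1 := poch_succ_param (2 * h + 1) i
    have a2 := poch_succ_param (2 * h) i
    calc poch (2 * h + 1 + 1) i * (2 * h * (2 * h + 1))
        = 2 * h * ((2 * h + 1) * poch (2 * h + 1 + 1) i) := by ring
      _ = 2 * h * (poch (2 * h + 1) i * (2 * h + 1 + i)) := by rw [a1]
      _ = (2 * h * poch (2 * h + 1) i) * (2 * h + 1 + i) := by ring
      _ = (poch (2 * h) i * (2 * h + i)) * (2 * h + 1 + i) := by rw [a2]
      _ = poch (2 * h) i * (2 * h + i) * (2 * h + i + 1) := by ring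
  rw [eP2, eP1, eQ2, eQ1, eR2, eS2, hU, hV, Nat.factorial_succ, Nat.factorial_succ]
  push_cast
  -- atomise the denominators for `field_simp`
  generalize eQ : poch (2 * h) i = Q at hQ ⊢
  generalize eP : poch h i = P at hP ⊢
  generalize eu1 : 2 * h + (i : ℝ) + 1 = u1
  generalize eu0 : 2 * h + (i : ℝ) = u0
  generalize et2 : 2 * h - 2 = t2
  generalize et1 : 2 * h - 1 = t1
  generalize et3 : 2 * h + 1 = t3
  have f1 : t2 ≠ 0 := by rw [← et2]; linarith
  have f2 : t1 ≠ 0 := by rw [← et1]; linarith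
  have f3 : t3 ≠ 0 := by rw [← et3]; linarith
  have f4 : u0 ≠ 0 := by rw [← eu0]; positivity
  have f5 : u1 ≠ 0 := by rw [← eu1]; positivity
  have f0 : (i.factorial : ℝ) ≠ 0 := by positivity
  have f7 : ((i : ℝ) + 1) ≠ 0 := by positivity
  have f8 : ((i : ℝ) + 1 + 1) ≠ 0 := by positivity
  field_simp
  subst eu1 eu0 et2 et1 et3
  ring

/-- **T1 (coefficient form of `z⁻¹ k_{2h} = k_{2h-2} + ½ k_{2h} + γ_h k_{2h+2}`)**: for `h > 1` and every
integer `i`, `κ_h(i) = κ_{h-1}(i) + ½ κ_h(i-1) + γ_h κ_{h+1}(i-2)`. [folklore] -/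
theorem sl2CoeffZ_inv {h : ℝ} (hh : 1 < h) (i : ℤ) :
    sl2CoeffZ h i = sl2CoeffZ (h - 1) i + 1 / 2 * sl2CoeffZ h (i - 1) + sl2Gamma h * sl2CoeffZ (h + 1) (i - 2) := by
  rcases lt_trichotomy i 0 with hi | rfl | hi
  · rw [sl2CoeffZ_of_neg _ hi, sl2CoeffZ_of_neg _ hi, sl2CoeffZ_of_neg _ (by omega),
      sl2CoeffZ_of_neg _ (by omega)]; ring
  · have e1 : sl2CoeffZ h (0 - 1) = 0 := sl2CoeffZ_of_neg h (by norm_num)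
    have e2 : sl2CoeffZ (h + 1) (0 - 2) = 0 := sl2CoeffZ_of_neg (h + 1) (by norm_num)
    rw [e1, e2, sl2CoeffZ_zero, sl2CoeffZ_zero]; ring
  · rcases lt_trichotomy i 1 with hi1 | rfl | hi1
    · omega
    · have a1 : sl2CoeffZ h 1 = h / 2 := by rw [sl2CoeffZ_one, sl2Coeff_one (by positivity)]
      have a2 : sl2CoeffZ (h - 1) 1 = (h - 1) / 2 := by rw [sl2CoeffZ_one, sl2Coeff_one (by linarith)]
      have a3 : sl2CoeffZ h (1 - 1) = 1 := by rw [sub_self, sl2CoeffZ_zero]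
      have a4 : sl2CoeffZ (h + 1) (1 - 2) = 0 := sl2CoeffZ_of_neg _ (by norm_num)
      rw [a1, a2, a3, a4]; ring
    · obtain ⟨n, rfl⟩ : ∃ n : ℕ, i = (n : ℤ) + 2 := ⟨(i - 2).toNat, by omega⟩
      have := sl2Coeff_T_main hh 1 n
      have h0 := sl2Coeff_T_main hh 0 n
      rw [show ((n:ℤ) + 2) - 1 = (n : ℤ) + 1 by ring, show ((n:ℤ) + 2) - 2 = (n : ℤ) by ring,
        sl2CoeffZ_natCast_add_two, sl2CoeffZ_natCast_add_two, sl2CoeffZ_natCast_add_one, sl2CoeffZ_natCast]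
      linear_combination this - h0

/-- **T2 (coefficient form of `(1-z) k_{2h}' = h k_{2h-2} - (h-1) γ_h k_{2h+2}`)**: for `h > 1` and every
integer `i`, `(h+i) κ_h(i) - (h+i-1) κ_h(i-1) = h κ_{h-1}(i) - (h-1) γ_h κ_{h+1}(i-2)`. [folklore] -/
theorem sl2CoeffZ_deriv {h : ℝ} (hh : 1 < h) (i : ℤ) :
    (h + i) * sl2CoeffZ h i - (h + i - 1) * sl2CoeffZ h (i - 1) =
      h * sl2CoeffZ (h - 1) i - (h - 1) * sl2Gamma h * sl2CoeffZ (h + 1) (i - 2) := by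
  rcases lt_trichotomy i 0 with hi | rfl | hi
  · rw [sl2CoeffZ_of_neg _ hi, sl2CoeffZ_of_neg _ hi, sl2CoeffZ_of_neg _ (by omega),
      sl2CoeffZ_of_neg _ (by omega)]; ring
  · have e1 : sl2CoeffZ h (0 - 1) = 0 := sl2CoeffZ_of_neg h (by norm_num)
    have e2 : sl2CoeffZ (h + 1) (0 - 2) = 0 := sl2CoeffZ_of_neg (h + 1) (by norm_num)
    rw [e1, e2, sl2CoeffZ_zero, sl2CoeffZ_zero]; push_cast; ring
  · rcases lt_trichotomy i 1 with hi1 | rfl | hi1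
    · omega
    · have a1 : sl2CoeffZ h 1 = h / 2 := by rw [sl2CoeffZ_one, sl2Coeff_one (by positivity)]
      have a2 : sl2CoeffZ (h - 1) 1 = (h - 1) / 2 := by rw [sl2CoeffZ_one, sl2Coeff_one (by linarith)]
      have a3 : sl2CoeffZ h (1 - 1) = 1 := by rw [sub_self, sl2CoeffZ_zero]
      have a4 : sl2CoeffZ (h + 1) (1 - 2) = 0 := sl2CoeffZ_of_neg _ (by norm_num)
      rw [a1, a2, a3, a4]; push_cast; ring
    · obtain ⟨n, rfl⟩ : ∃ n : ℕ, i = (n : ℤ) + 2 := ⟨(i - 2).toNat, by omega⟩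
      have h0 := sl2Coeff_T_main hh 0 n
      rw [show ((n:ℤ) + 2) - 1 = (n : ℤ) + 1 by ring, show ((n:ℤ) + 2) - 2 = (n : ℤ) by ring,
        sl2CoeffZ_natCast_add_two, sl2CoeffZ_natCast_add_two, sl2CoeffZ_natCast_add_one, sl2CoeffZ_natCast]
      push_cast
      linear_combination (-1 : ℝ) * h0

/-- The `μ`-family **T_μ = μ·T1 + T2**: for `h > 1`, every real `μ` and every integer `i`,
`(μ - h - i) κ_h(i) + (h+i-1) κ_h(i-1) = (μ-h) κ_{h-1}(i) + (μ/2) κ_h(i-1) + (μ+h-1) γ_h κ_{h+1}(i-2)`: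
the coefficient of `z^{h-1+i}` in `μ z⁻¹ k_{2h} - (1-z) k_{2h}' = (μ-h) k_{2h-2} + (μ/2) k_{2h} + (μ+h-1) γ_h k_{2h+2}`.
[folklore] -/
theorem sl2CoeffZ_T {h : ℝ} (hh : 1 < h) (μ : ℝ) (i : ℤ) :
    (μ - h - i) * sl2CoeffZ h i + (h + i - 1) * sl2CoeffZ h (i - 1) =
      (μ - h) * sl2CoeffZ (h - 1) i + μ / 2 * sl2CoeffZ h (i - 1) +
        (μ + h - 1) * sl2Gamma h * sl2CoeffZ (h + 1) (i - 2) := by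
  have h1 := sl2CoeffZ_inv hh i
  have h2 := sl2CoeffZ_deriv hh i
  linear_combination μ * h1 - h2

/-- Main case of **T0**. [folklore] -/
private theorem sl2Coeff_T0_main {h : ℝ} (hh : 0 < h) (i : ℕ) :
    ((i : ℝ) + 2) * sl2Coeff h (i + 2) =
      (h / 2 + i + 1) * sl2Coeff h (i + 1) - sl2Gamma' h * sl2Coeff (h + 1) i := by
  unfold sl2Coeff sl2Gamma'
  have eP2 : poch h (i + 2) = poch h i * (h + i) * (h + i + 1) := by
    rw [poch_succ, poch_succ]; push_cast; ring
  have eP1 : poch h (i + 1) = poch h i * (h + i) := poch_succ h i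
  have eQ2 : poch (2 * h) (i + 2) = poch (2 * h) i * (2 * h + i) * (2 * h + i + 1) := by
    rw [poch_succ, poch_succ]; push_cast; ring
  have eQ1 : poch (2 * h) (i + 1) = poch (2 * h) i * (2 * h + i) := poch_succ (2 * h) i
  have hP : poch h i ≠ 0 := poch_ne_zero hh i
  have hQ : poch (2 * h) i ≠ 0 := poch_ne_zero (by linarith) i
  have h0 : h ≠ 0 := hh.ne'
  have hU : poch (h + 1) i = poch h i * (h + i) / h := by
    rw [eq_div_iff h0, mul_comm, poch_succ_param]
  have hV : poch (2 * (h + 1)) i = poch (2 * h) i * (2 * h + i) * (2 * h + i + 1) / ((2 * h) * (2 * h + 1)) := by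
    have hne : (2 * h) * (2 * h + 1) ≠ 0 := by positivity
    rw [eq_div_iff hne]
    have e5 : 2 * (h + 1) = (2 * h + 1) + 1 := by ring
    rw [e5]
    have a1 := poch_succ_param (2 * h + 1) i
    have a2 := poch_succ_param (2 * h) i
    calc poch (2 * h + 1 + 1) i * (2 * h * (2 * h + 1))
        = 2 * h * ((2 * h + 1) * poch (2 * h + 1 + 1) i) := by ring
      _ = 2 * h * (poch (2 * h + 1) i * (2 * h + 1 + i)) := by rw [a1]
      _ = (2 * h * poch (2 * h + 1) i) * (2 * h + 1 + i) := by ring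
      _ = (poch (2 * h) i * (2 * h + i)) * (2 * h + 1 + i) := by rw [a2]
      _ = poch (2 * h) i * (2 * h + i) * (2 * h + i + 1) := by ring
  rw [eP2, eP1, eQ2, eQ1, hU, hV, Nat.factorial_succ, Nat.factorial_succ]
  push_cast
  generalize eQ : poch (2 * h) i = Q at hQ ⊢
  generalize eP : poch h i = P at hP ⊢
  generalize eu1 : 2 * h + (i : ℝ) + 1 = u1
  generalize eu0 : 2 * h + (i : ℝ) = u0
  generalize et3 : 2 * h + 1 = t3
  have f3 : t3 ≠ 0 := by rw [← et3]; linarith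
  have f4 : u0 ≠ 0 := by rw [← eu0]; positivity
  have f5 : u1 ≠ 0 := by rw [← eu1]; positivity
  have f0 : (i.factorial : ℝ) ≠ 0 := by positivity
  have f7 : ((i : ℝ) + 1) ≠ 0 := by positivity
  have f8 : ((i : ℝ) + 1 + 1) ≠ 0 := by positivity
  field_simp
  subst eu1 eu0 et3
  ring

/-- **T0 (coefficient form of `h z⁻¹ k_{2h} - (1-z) k_{2h}' = (h/2) k_{2h} + γ'_h k_{2h+2}`)**: for `h > 0`
and every integer `i`, `i κ_h(i) = (h/2 + i - 1) κ_h(i-1) - γ'_h κ_{h+1}(i-2)`. This is the `μ = h` member of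
the family `sl2CoeffZ_T`, in which `k_{2h-2}` does not occur, written so that it stays valid down to
`h ≤ 1` (no `γ_h`, no `κ_{h-1}`). [folklore] -/
theorem sl2CoeffZ_comb {h : ℝ} (hh : 0 < h) (i : ℤ) :
    (i : ℝ) * sl2CoeffZ h i = (h / 2 + i - 1) * sl2CoeffZ h (i - 1) - sl2Gamma' h * sl2CoeffZ (h + 1) (i - 2) := by
  rcases lt_trichotomy i 0 with hi | rfl | hi
  · rw [sl2CoeffZ_of_neg _ hi, sl2CoeffZ_of_neg _ (by omega), sl2CoeffZ_of_neg _ (by omega)]; ring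
  · have e1 : sl2CoeffZ h (0 - 1) = 0 := sl2CoeffZ_of_neg h (by norm_num)
    have e2 : sl2CoeffZ (h + 1) (0 - 2) = 0 := sl2CoeffZ_of_neg (h + 1) (by norm_num)
    rw [e1, e2, sl2CoeffZ_zero]; push_cast; ring
  · rcases lt_trichotomy i 1 with hi1 | rfl | hi1
    · omega
    · have a1 : sl2CoeffZ h 1 = h / 2 := by rw [sl2CoeffZ_one, sl2Coeff_one hh.ne']
      have a3 : sl2CoeffZ h (1 - 1) = 1 := by rw [sub_self, sl2CoeffZ_zero]
      have a4 : sl2CoeffZ (h + 1) (1 - 2) = 0 := sl2CoeffZ_of_neg _ (by norm_num)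
      rw [a1, a3, a4]; push_cast; ring
    · obtain ⟨n, rfl⟩ : ∃ n : ℕ, i = (n : ℤ) + 2 := ⟨(i - 2).toNat, by omega⟩
      have h0 := sl2Coeff_T0_main hh n
      rw [show ((n:ℤ) + 2) - 1 = (n : ℤ) + 1 by ring, show ((n:ℤ) + 2) - 2 = (n : ℤ) by ring,
        sl2CoeffZ_natCast_add_two, sl2CoeffZ_natCast_add_one, sl2CoeffZ_natCast]
      push_cast
      linear_combination h0


end Literature.MathematicalPhysics.QuantumFieldTheory.ConformalBootstrap3D
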